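import Literature.NumberTheory.EllipticCurves.HeegnerPointsKolyvaginPrimaryRamifiedProofs
import Literature.NumberTheory.EllipticCurves.HeegnerPointsKolyvaginGoodReductionProofs
import Literature.NumberTheory.GaloisRepresentations.DecompositionGroupOfCompletion
import Literature.NumberTheory.GaloisRepresentations.FrobeniusGeneration
import HarnessLib

/-!
# `Γ_{K_λ}` acts trivially on `E[q]` at a Kolyvagin prime `λ` of level `q`

Topic `NumberTheory/EllipticCurves`; namespace `Literature.NumberTheory.EllipticCurves`. Theorems only:
**no definition and no named fact is introduced** (D-0026). Sibling of
`HeegnerPointsKolyvaginPrimaryRamifiedProofs` (`exists_isArithFrobAt_mem_torsionFixing`: at a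
Kolyvagin prime `ℓ` with `Frob(ℓ) = Frob(∞)` on `E[q]`, every prime `𝔔 ∣ λ` of `\bar ℤ_K` carries an
arithmetic Frobenius acting trivially on `E(K̄)[q]`).

McCallum 1991, §4 (PDF p. 283): *"Let `ℓ` be a rational prime in `S₁(M)` … Then `λ` splits completely
in `K(E_{p^M})`, hence `E(K_λ)_{p^M} = E_{p^M}`"*; Gross 1991, §3 after (3.2) / §6. In the tree's
vocabulary: for `K` imaginary quadratic, `ℓ` a Kolyvagin prime (`IsKolyvaginPrime N W K p ℓ`, place
`λ = (ℓ)`) with `FrobEqFrobInfty W K q ℓ`, `E/K` with good reduction at `λ` and `λ ∤ q`, the absolute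
Galois group of the completion `K_λ` acts TRIVIALLY on `E(K̄)[q]` through the restriction
`res : Γ_{K_λ} → Γ_K` along the chosen embedding `K̄ → \bar K_λ`:

* `absGaloisRestrict_smul_geomTorsion_eq_of_kolyvaginPrime` — `res(g) • Q = Q` for all `g ∈ Γ_{K_λ}`,
  `Q ∈ E(K̄)[q]`. Proof (the local half of x11b3's `KolyvaginReciprocityOfPoitouTate`, isolated): the
  decomposition group `D_{𝔓₀} = res(Γ_{K_λ})` of the prime `𝔓₀ ∣ λ` cut out by the embedding
  (`decompositionSubgroup_adicCompletionPrime_eq_range`, Neukirch II (9.6)) is `⟨F⟩ · I_{𝔓₀} · U` for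
  the Frobenius `F` of `exists_isArithFrobAt_mem_torsionFixing` and the open subgroup
  `U = Γ_{K(E[q])}` (`exists_eq_frobenius_pow_mul_of_mem_decompositionSubgroup`, Neukirch I (9.4));
  `F ∈ U` by construction and `I_{𝔓₀} ≤ U` by good reduction at `λ ∤ q`
  (`smul_geomTorsion_eq_of_mem_inertia`, Silverman VII.4.1).
* `absGaloisRestrict_smul_geomTorsion_eq_of_kolyvaginPrime_pow` — the case `q = p^M` with the
  good-reduction and coprimality hypotheses discharged from a Heegner point of level `N`
  (`IsKolyvaginPrime.not_mem_badPlaces`) and `ℓ ≠ p`.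

Use: the local exactness / injectivity of `ι_* : H¹(K_λ, E[m]) → H¹(K_λ, E[m²])` at Kolyvagin primes
of level `m²` (`CasselsTateSelmerLocalValue.map_inclKD_restrictField_injective_of_forall_smul_eq`) and
the hypothesis `htriv` of the tame cup-product computations at `λ` (Gross (7.6)).

## References

* [McCallumLMS1991] W. G. McCallum, *Kolyvagin's work on Shafarevich–Tate groups* (1991), §4.
* [GrossLMS1991] B. H. Gross, *Kolyvagin's work on modular elliptic curves* (1991), §3 (3.1)–(3.2), §6.
* [NeukirchANT1999] J. Neukirch, *Algebraic Number Theory* (1999), I §9 (9.4), II §9 (9.6).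
* [SilvermanAEC2009] J. H. Silverman, *The Arithmetic of Elliptic Curves* (2009), Prop. VII.4.1(a).
-/

noncomputable section

open scoped Classical Pointwise

universe u

namespace Literature.NumberTheory.EllipticCurves

open _root_.WeierstrassCurve NumberField IsDedekindDomain Field Function
open Literature.NumberTheory.GaloisRepresentations

variable (W : WeierstrassCurve ℚ) {K : Type u} [Field K] [NumberField K]

/-- **`Γ_{K_λ}` fixes `E(K̄)[q]` at a Kolyvagin prime of level `q`** (McCallum 1991, §4: *"`λ`
splits completely in `K(E_{p^M})`, hence `E(K_λ)_{p^M} = E_{p^M}`"*). For `K` imaginary quadratic,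
`ℓ` a Kolyvagin prime with `Frob(ℓ) = Frob(∞)` on `E[q]`, `E/K` of good reduction at `λ = (ℓ)` and
`λ ∤ q`: every `g ∈ Γ_{K_λ}` acts trivially on `E(K̄)[q]` through `res : Γ_{K_λ} → Γ_K`.
[cite: McCallumLMS1991, §4] [cite: GrossLMS1991, §3 (3.2)] [cite: NeukirchANT1999, Ch. II §9 Prop. (9.6)] -/
theorem absGaloisRestrict_smul_geomTorsion_eq_of_kolyvaginPrime [W.IsElliptic]
    (hK : IsImaginaryQuadratic K) {N p ℓ : ℕ} (hℓ : IsKolyvaginPrime N W K p ℓ) {q : ℕ} [NeZero q]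
    (hℓq : FrobEqFrobInfty W K q ℓ) (hbad : hℓ.place ∉ (W.baseChange K).badPlaces (𝓞 K))
    (hqlam : (((q : ℕ) : ℤ) : 𝓞 K) ∉ hℓ.place.asIdeal)
    (g : absoluteGaloisGroup (hℓ.place.adicCompletion K)) (Q : geomTorsion (W.baseChange K) (q : ℤ)) :
    absGaloisRestrict K (hℓ.place.adicCompletion K) g • Q = Q := by
  have hq0 : ((q : ℕ) : ℤ) ≠ 0 := Int.natCast_ne_zero.mpr (NeZero.ne q)
  have hgood : (W.baseChange K).HasGoodReductionAt hℓ.place := by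
    have h := hbad
    rwa [WeierstrassCurve.mem_badPlaces_iff, not_not] at h
  -- the prime `𝔓₀ ∣ λ` cut out by `K̄ → \bar K_λ`, a Frobenius there fixing `E[q]`, and `D_{𝔓₀} = res Γ_{K_λ}`
  have h𝔓₀ : adicCompletionPrime K hℓ.place ∈ hℓ.place.primesAbove := adicCompletionPrime_mem_primesAbove K hℓ.place
  obtain ⟨F, hF, hFfix⟩ := exists_isArithFrobAt_mem_torsionFixing W hK hℓ hℓq h𝔓₀
  have hDeq := decompositionSubgroup_adicCompletionPrime_eq_range K hℓ.place
  -- inertia at `𝔓₀` fixes `E[q]` (good reduction, `λ ∤ q`)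
  have hI₀ : (adicCompletionPrime K hℓ.place).inertia (absoluteGaloisGroup K) ≤
      torsionFixing (W.baseChange K) (q : ℤ) := fun τ hτ =>
    (mem_torsionFixing_iff _ _).mpr fun Q' =>
      (W.baseChange K).smul_geomTorsion_eq_of_mem_inertia hgood hqlam h𝔓₀ hτ Q'
  -- `res g ∈ D_{𝔓₀} = ⟨F⟩ · I_{𝔓₀} · Γ_{K(E[q])}`
  have hd : absGaloisRestrict K (hℓ.place.adicCompletion K) g ∈
      (adicCompletionPrime K hℓ.place).decompositionSubgroup (absoluteGaloisGroup K) := by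
    rw [hDeq]; exact ⟨g, rfl⟩
  obtain ⟨k, i, u, hi, hu, hdeq⟩ := exists_eq_frobenius_pow_mul_of_mem_decompositionSubgroup
    h𝔓₀ hF (isOpen_torsionFixing (W.baseChange K) hq0) hd
  have hmem : absGaloisRestrict K (hℓ.place.adicCompletion K) g ∈ torsionFixing (W.baseChange K) (q : ℤ) := by
    rw [hdeq]
    exact Subgroup.mul_mem _ (Subgroup.mul_mem _ (Subgroup.pow_mem _ hFfix k) (hI₀ hi)) hu
  exact smul_eq_of_mem_torsionFixing _ _ hmem Q

/-- **The case `q = p^M` at a Kolyvagin prime of level `M` for `(E, K, y_K)`**: given a Heegner point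
of level `N` over `K` (so that `E/K` has good reduction at every Kolyvagin prime,
`IsKolyvaginPrime.not_mem_badPlaces`) and `M`, every `g ∈ Γ_{K_λ}` fixes `E(K̄)[p^M]`, for `ℓ` a
Kolyvagin prime with `Frob(ℓ) = Frob(∞)` on `E[p^M]` (`λ ∤ p^M` as `ℓ ≠ p`).
[cite: McCallumLMS1991, §4] [cite: GrossLMS1991, §3 (3.1)–(3.2)] -/
theorem absGaloisRestrict_smul_geomTorsion_eq_of_kolyvaginPrime_pow [W.IsElliptic]
    (hK : IsImaginaryQuadratic K) {N : ℕ} [NeZero N] {P : (W.baseChange K).toAffine.Point}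
    (hP : IsHeegnerPoint N W K P) {p : ℕ} (hp : p.Prime) {ℓ : ℕ} (hℓ : IsKolyvaginPrime N W K p ℓ)
    (M : ℕ) (hℓM : FrobEqFrobInfty W K (p ^ M) ℓ)
    (g : absoluteGaloisGroup (hℓ.place.adicCompletion K))
    (Q : geomTorsion (W.baseChange K) ((p ^ M : ℕ) : ℤ)) :
    absGaloisRestrict K (hℓ.place.adicCompletion K) g • Q = Q := by
  haveI : NeZero (p ^ M) := ⟨pow_ne_zero _ hp.ne_zero⟩
  have hpv : ((p : ℕ) : 𝓞 K) ∉ hℓ.place.asIdeal :=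
    not_natCast_mem_of_prime_ne hℓ.prime hp hℓ.2.2.2.1 hℓ.place hℓ.mem_place
  have hqv : ((((p ^ M : ℕ) : ℤ)) : 𝓞 K) ∉ hℓ.place.asIdeal := by
    rw [Int.cast_natCast, Nat.cast_pow]
    exact fun h => hpv (hℓ.place.isPrime.mem_of_pow_mem M h)
  exact absGaloisRestrict_smul_geomTorsion_eq_of_kolyvaginPrime W hK hℓ hℓM
    (hℓ.not_mem_badPlaces hP) hqv g Q

end Literature.NumberTheory.EllipticCurves

end
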